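import Summits.BirchSwinnertonDyer.Rank1Residual.X11b.KolyvaginLeafInputsDischarged
import Summits.BirchSwinnertonDyer.Rank1Residual.X11b.KolyvaginHpointsAssembly
import Summits.BirchSwinnertonDyer.Rank1Residual.X11b.HeegnerTraceRelation
import Summits.BirchSwinnertonDyer.Rank1Residual.X11b.KolyvaginHeegnerTowerData
import Literature.NumberTheory.EllipticCurves.GrossLMS1991.HeegnerEulerSystemCongruenceImageFree
import Summits.BirchSwinnertonDyer.BirchSwinnertonDyer.Theorems.ClassRecordThreeCornerAtThreeShimuraWalkDefs
import HarnessLib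

/-!
# The Heegner points of `X₀(N)` of EVERY conductor prime to `N` as a LABELLED family — the input currency
# `ShimuraWalk.LabelsAt` of lane B's image-keyed Kolyvagin machine at `S = ∅` (crux `CornerAtThreeW`, item
# stmt-BirchSwinnertonDyer-21420; cell `bsd-stepL`, seat `bsd-stepL-corner3-p2` g11 = WIDTH-LEVER lane B;
# `--supports stmt-BirchSwinnertonDyer-21420 --as helper`)

WHY. Lane B's image-keyed «SHIFT×DIV» Kolyvagin ORDER machine (`ShimuraKolyvaginOfImage.*`, this seat g5 + tam3-p1 g11:
D6 `hpointsRkDiv_of_shimuraLabels_of_noTorsion_of_divLab` → D5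
`padicValNat_card_sha_primary_add_le_of_ringClassRationalPointsMDiv_shift_of_poitouTate_of_localDuality_ofImage`) consumes a family
`ys m ∈ E(K[m])` through SIX printed labels only — `ε = ±1`, (B2) Gross (4.1) bottom trace, (B3) Gross 5.3 conjugation, (B3₀) its
conductor-`1` form, (B4) Gross 3.7 (1) trace relation, (B5) Gross 3.7 (2) congruence — with NO reference to the Shimura curve. THIS FILE
produces that labelled family for the MODULAR curve `X₀(N)` itself (the case `S = ∅`): the Heegner points `y(m) = φ(x(m)) ∈ E(K[m])` of every
square-free conductor `m` prime to `N` with inert prime factors (CM rationality = the tree THEOREM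
`phi_heegnerPointOfConductor_mem_range_map_ringClassField_holds`), extended by `0` elsewhere, with bottom point the consumer's `P ∈ E(K)`
(`P(1) = y_K` on the frame of a conductor-`1` datum `d₁`). Every label is a KERNEL theorem except (B5), which is the ONE image-free print
input `GrossLMS1991.prop37_2_frobeniusCongruence` (Gross 1991 Prop. 3.7 (2) = Nekovář 2007 Prop. 4.13 (ii), `ℓ ≠ 2`): (B2) by
`KolyvaginHeegnerData.mem_S_iff` + `KolyvaginBottom.toGeomPoints_map_algebraMap`; (B3) by x11b3's reduction `KolyvaginA53.h53_of_recM_of_eq_conductorNorm`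
over the tree's Shimura reciprocity at conductor `m` (`exists_mem_ringClassGal_map_pointGalHom_y_eq_of_heegnerHypothesis`); (B3₀) by Darmon 3.11
(`KolyvaginAssembly.isOfFinAddOrder_map_sub_of_eq_conductorNorm`, with `IsHeegnerPoint` from `heegnerPointOfConductor_one_galoisConj_holds`);
(B4) by x11b3's `HeegnerTrace.sum_pow_pointGalHom_y_eq_lFunction_smul_map` (Eichler–Shimura on CM divisors, PROVED there) on coherent data of
`RingClassTower.exists_coherent_kolyvaginHeegnerData` with the generator at `ℓ` UPDATED to the given one; (B5) by
`GrossLMS1991.prop37_2_frobeniusCongruence.reductionCongruence` on the datum whose embedding `K[m] → K̄` is the GIVEN one. The side condition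
«`2` is not inert in `K`» makes Nekovář's `ℓ ≠ 2` automatic (on the corner's `d_K ≡ 1 (mod 8)` frames `2` splits; RULING 38).

CONSEQUENCE (successor file `…ChaStructureOfImage`): fed to D6 → D5 with the four image inputs at `p = 3`
(`kolyvaginImageInputs_three_of_not_dvd_discr`), x11b3's `NoTorsionIrr` and the Cassels–Tate level inputs, it yields Cha 2005 Rmk. 25's
upper half `ord₃ #Ш(E/K)[3^∞] + 2t ≤ 2M₀` for EVERY irreducible `E[3]` BY KERNEL (the named fact
`Cha2005.rmk25_padicValNat_card_sha_primary_add_le_of_globalDivisibility` = `hChaU` of the mono-carrier branch of 21420's `Lines/inert.lean`).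

HONEST FRAMING: TWO THEOREMS (no definition, no named fact, no `sorry`, no instance); CONDITIONAL on the displayed congruence fact `h372`;
an ASSEMBLY of tree theorems (credit: x11b3 = cell b2b-bsdres — CM rationality, reciprocity, trace relation, tower data, bottom point;
bsd-uniform lit — the image-free congruence text); nothing about `Ш`; no stub closes; items 21420 ∕ 19111 are NOT closed; BSD is not
proved for any curve; T7.

References: [GrossLMS1991] §3 Prop. 3.7 (1)(2), §4 (4.1), §5 (5.2), Prop. 5.3; [Nekovar2007] Prop. 4.9, 4.13 (ii); [Darmon2004] Thm. 3.6,
Thm. 3.7, Prop. 3.11; [Gross1984] §5; [McCallumLMS1991] §4.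
presearch: «Heegner points of all conductors as an Euler system with Gross's labels, formal» → [corpus: book:editornd-l-functions-arithmetic
p0216–p0220 (Gross §§3–5)] gives the printed labels; tree: the five x11b3 theorems above (lean search 'HeegnerTrace|KolyvaginA53|mem_S_iff');
nothing to mint.
-/

set_option autoImplicit false
set_option linter.dupNamespace false

noncomputable section

open scoped Classical NumberField

namespace Summit.BirchSwinnertonDyer.BirchSwinnertonDyer.Theorems.ModularHeegnerLabels

open WeierstrassCurve Field NumberField IsDedekindDomain Finset
open Literature.NumberTheory.EllipticCurves Literature.NumberTheory.GaloisRepresentations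
  Literature.NumberTheory.EllipticCurves.RingClassField Literature.NumberTheory.EllipticCurves.ModularForms
  Summit.BirchSwinnertonDyer.Rank1Residual.X11b

-- `K : Type`: the tree's ring-class class field theory is universe `0`.
variable {K : Type} [Field K] [NumberField K] {N : ℕ} {W : WeierstrassCurve ℚ}

/-- **The `X₀(N)` Heegner points of every conductor as a LABELLED family** (Gross 1991 §§3–5 labels, the input of lane B's
image-keyed Kolyvagin machine at `S = ∅`). For `E = W/ℚ` elliptic and globally minimal of conductor `N`, `K` imaginary quadratic with
`d_K ∉ {−3, −4}` and the Heegner hypothesis for `N`, `2` NOT inert in `K`, a frame `(Dt, β, ι)` with a conductor-`1` Kolyvagin–Heegner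
datum `d₁` whose derived point is `P ∈ E(K)` in `E(K̄)`, and the image-free congruence `h372`: there is a family `ys m ∈ E(K[m])` with
`ys 1 = d₁.y`, `ys m ↦ φ(x(m))` at every square-free `m` with prime factors `∤ N` inert in `K`, and the six labels (B2)–(B5) of
`ShimuraWalk.LabelsAt` for `(ι, P, ys, ε := −w(E))` — in EXACTLY the binder shapes of D6
`ShimuraKolyvaginOfImage.hpointsRkDiv_of_shimuraLabels_of_noTorsion_of_divLab`. CONDITIONAL on `h372`; assembly of tree theorems.
[cite: GrossLMS1991, §3 Prop. 3.7 (1)(2), §4 (4.1), Prop. 5.3] [cite: Nekovar2007, Prop. 4.13 (ii)] [cite: Darmon2004, Thm. 3.7, Prop. 3.11] -/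
theorem exists_labelledFamily [NeZero N] [W.IsElliptic] [W.IsGloballyMinimal]
    (hN : W.conductorNorm ℤ = N) (hK : IsImaginaryQuadratic K)
    (hD34 : NumberField.discr K ≠ -3 ∧ NumberField.discr K ≠ -4)
    (hH : SatisfiesHeegnerHypothesis N K)
    (h2 : ¬ (Ideal.span {((2 : ℕ) : 𝓞 K)}).IsPrime)
    (h372 : GrossLMS1991.prop37_2_frobeniusCongruence)
    (Dt : ModularParametrizationData W N) {β : ℤ} (ι : K →+* ℂ)
    (d₁ : KolyvaginHeegnerData Dt β ι 1) {P : (W.baseChange K).toAffine.Point}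
    (hPd : d₁.toGeomPoints d₁.derivedPoint = toGeomPoints (W.baseChange K) P) :
    ∃ ys : (m : ℕ) → (W.baseChange (ringClassField K ι m)).toAffine.Point,
      ys 1 = d₁.y ∧
      (∀ m : ℕ, Squarefree m → (∀ q ∈ m.primeFactors, ¬ q ∣ N ∧ (Ideal.span {(q : 𝓞 K)}).IsPrime) →
        WeierstrassCurve.Affine.Point.map (W' := W) (ringClassField K ι m).subtype.toRatAlgHom (ys m) =
          heegnerPointComplexOfConductor Dt (NumberField.discr K) β m) ∧
      ((-W.rootNumber : ℤ) = 1 ∨ (-W.rootNumber : ℤ) = -1) ∧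
      (∀ T : Finset (ringClassField K ι 1 ≃ₐ[ℚ] ringClassField K ι 1),
        (∀ g, g ∈ T ↔ g ∈ ringClassGal ι 1) →
        WeierstrassCurve.Affine.Point.map (W' := W)
            (algebraMap K (ringClassField K ι 1)).toRatAlgHom P =
          ∑ g ∈ T, pointGalHom W (ringClassField K ι 1) g (ys 1)) ∧
      (∀ (m : ℕ), m ≠ 0 → ∀ τm : ringClassField K ι m ≃ₐ[ℚ] ringClassField K ι m,
        (∀ x : ringClassField K ι m, ((τm x : ringClassField K ι m) : ℂ) = starRingEnd ℂ x) →
        ∃ σ' ∈ ringClassGal ι m, IsOfFinAddOrder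
          (pointGalHom W (ringClassField K ι m) τm (ys m) -
            (-W.rootNumber : ℤ) • pointGalHom W (ringClassField K ι m) σ' (ys m))) ∧
      (∀ c : K ≃ₐ[ℚ] K, c ≠ 1 →
        IsOfFinAddOrder (WeierstrassCurve.Affine.Point.map (W' := W) (c : K →ₐ[ℚ] K) P - (-W.rootNumber : ℤ) • P)) ∧
      (∀ m : ℕ, Squarefree m →
        (∀ q ∈ m.primeFactors, ¬ q ∣ N ∧ (Ideal.span {(q : 𝓞 K)}).IsPrime) →
        ∀ (ℓ : ℕ) (_ : ℓ ∈ m.primeFactors) (hle : ringClassField K ι (m / ℓ) ≤ ringClassField K ι m)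
          (σ : ringClassField K ι m ≃ₐ[ℚ] ringClassField K ι m),
          Subgroup.zpowers σ = ringClassGalOver ι m (m / ℓ) →
          letI : Algebra K ℂ := ι.toAlgebra
          ∑ i ∈ Finset.range (ℓ + 1), pointGalHom W (ringClassField K ι m) (σ ^ i) (ys m) =
            W.frobeniusTrace ℓ • WeierstrassCurve.Affine.Point.map (W' := W)
              ((RingClassField.inclusion ι hle).restrictScalars ℚ) (ys (m / ℓ))) ∧
      (∀ m : ℕ, Squarefree m →
        (∀ q ∈ m.primeFactors, ¬ q ∣ N ∧ (Ideal.span {(q : 𝓞 K)}).IsPrime) →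
        ∀ (ℓ : ℕ) (_ : ℓ ∈ m.primeFactors) [Fact ℓ.Prime] (hΔ : ¬ (ℓ : ℤ) ∣ minimalDiscriminantInt W)
          (φ₀ : absoluteGaloisGroup (ZMod ℓ)), (∀ x : AlgebraicClosure (ZMod ℓ), φ₀ • x = x ^ ℓ) →
        ∀ (hle : ringClassField K ι (m / ℓ) ≤ ringClassField K ι m)
          (emb : ringClassField K ι m →+* AlgebraicClosure K),
          (∀ x : K, emb (algebraMap K (ringClassField K ι m) x) = algebraMap K (AlgebraicClosure K) x) →
        ∀ (j : (W.baseChange (ringClassField K ι m)).toAffine.Point →+ geomPoints (W.baseChange K)),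
          j = WeierstrassCurve.Affine.Point.map (W' := W) emb.toRatAlgHom →
        ∀ γ : ringClassField K ι m ≃ₐ[ℚ] ringClassField K ι m, γ ∈ ringClassGal ι m →
          letI : Algebra K ℂ := ι.toAlgebra
          geomReduction hΔ ((RatClosure.pointsEquiv (K := K) W).symm
              (j (pointGalHom W (ringClassField K ι m) γ (ys m)))) =
            φ₀ • geomReduction hΔ ((RatClosure.pointsEquiv (K := K) W).symm
              (j (pointGalHom W (ringClassField K ι m) γ
                (WeierstrassCurve.Affine.Point.map (W' := W)
                  ((RingClassField.inclusion ι hle).restrictScalars ℚ) (ys (m / ℓ))))))) := by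
  -- standing consequences of the frame
  have hD : NumberField.discr K < -4 := KolyvaginAssembly.discr_lt_neg_four hK hD34
  have hND : IsCoprime (N : ℤ) (NumberField.discr K) :=
    KolyvaginAssembly.isCoprime_discr_of_satisfiesHeegnerHypothesis hK hH
  have hβ : (4 * N : ℤ) ∣ β ^ 2 - NumberField.discr K := d₁.dvd_sq_sub
  -- the «good» conductors: square-free, prime factors prime to `N` and inert in `K`
  let Good : ℕ → Prop := fun m ↦
    Squarefree m ∧ ∀ q ∈ m.primeFactors, ¬ q ∣ N ∧ (Ideal.span {(q : 𝓞 K)}).IsPrime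
  have hgood0 : ∀ m, Good m → m ≠ 0 := fun m hm ↦ hm.1.ne_zero
  have hgoodcop : ∀ m, Good m → Nat.Coprime m N := fun m hm ↦
    Nat.coprime_of_dvd fun k hk hkm hkN ↦
      (hm.2 k (Nat.mem_primeFactors.mpr ⟨hk, hkm, hm.1.ne_zero⟩)).1 hkN
  have hgood_dvd : ∀ m k, Good m → k ∣ m → Good k := fun m k hm hk ↦
    ⟨hm.1.squarefree_of_dvd hk, fun q hq ↦ hm.2 q (Nat.primeFactors_mono hk hm.1.ne_zero hq)⟩
  have hgood1 : Good 1 := ⟨squarefree_one, by simp⟩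
  -- CM rationality at every good conductor (tree theorem, x11b3 / Darmon 2004 Thm. 3.6 at conductor `m`)
  have hCM : ∀ m, Good m → ∃ y : (W.baseChange (ringClassField K ι m)).toAffine.Point,
      WeierstrassCurve.Affine.Point.map (W' := W) (ringClassField K ι m).subtype.toRatAlgHom y =
        heegnerPointComplexOfConductor Dt (NumberField.discr K) β m := fun m hm ↦
    phi_heegnerPointOfConductor_mem_range_map_ringClassField_holds N W K hK hH Dt β ι m hβ
      (hgood0 m hm) (hgoodcop m hm)
  -- THE FAMILY: the Heegner point of conductor `m` at good `m`, `0` elsewhere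
  let ys : (m : ℕ) → (W.baseChange (ringClassField K ι m)).toAffine.Point := fun m ↦
    if hm : Good m then Classical.choose (hCM m hm) else 0
  have hys : ∀ m, Good m →
      WeierstrassCurve.Affine.Point.map (W' := W) (ringClassField K ι m).subtype.toRatAlgHom (ys m) =
        heegnerPointComplexOfConductor Dt (NumberField.discr K) β m := fun m hm ↦ by
    simp only [ys, dif_pos hm]
    exact Classical.choose_spec (hCM m hm)
  have hys0 : ∀ m, ¬ Good m → ys m = 0 := fun m hm ↦ by simp only [ys, dif_neg hm]
  have hys1 : ys 1 = d₁.y :=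
    WeierstrassCurve.Affine.Point.map_injective (W' := W)
      (f := (ringClassField K ι 1).subtype.toRatAlgHom) (by rw [hys 1 hgood1, d₁.map_y])
  -- Kolyvagin–Heegner data along the divisors of a good conductor, carrying the family (x11b3-p8's tower)
  have hdata : ∀ m, Good m → ∃ d : (k : ℕ) → k ∣ m → KolyvaginHeegnerData Dt β ι k,
      ∀ k (hk : k ∣ m), (d k hk).y = ys k := by
    intro m hm
    obtain ⟨d, hdy, -⟩ := RingClassTower.exists_coherent_kolyvaginHeegnerData Dt hK ι hm.1
      (fun q hq ↦ (hm.2 q hq).2) hβ (fun k _ ↦ ys k) (fun k hk ↦ hys k (hgood_dvd m k hm hk))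
    exact ⟨d, hdy⟩
  -- Shimura reciprocity at conductor `1` (tree theorem) ⟹ `P ↦ P(1)` in `E(K[1])` and `IsHeegnerPoint`
  have hrec := heegnerPointOfConductor_one_galoisConj_holds N W K
  have hmapP : WeierstrassCurve.Affine.Point.map (W' := W)
      (algebraMap K (ringClassField K ι 1)).toRatAlgHom P = d₁.derivedPoint := by
    apply WeierstrassCurve.Affine.Point.map_injective (W' := W) d₁.emb.toRatAlgHom
    change d₁.toGeomPoints _ = d₁.toGeomPoints _
    rw [KolyvaginBottom.toGeomPoints_map_algebraMap d₁ P, hPd]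
  obtain ⟨H, hHβ⟩ := exists_heegnerDatum N hK.discr_neg d₁.dvd_sq_sub
  have hPH : WeierstrassCurve.Affine.Point.map (W' := W) ι.toRatAlgHom P = heegnerPointComplex Dt H := by
    have hι : ι.toRatAlgHom = (ringClassField K ι 1).subtype.toRatAlgHom.comp
        (algebraMap K (ringClassField K ι 1)).toRatAlgHom := by
      ext x
      rfl
    rw [hι, ← WeierstrassCurve.Affine.Point.map_map, hmapP]
    exact KolyvaginBottom.map_derivedPoint_one_eq_heegnerPointComplex hrec hK hH d₁ H hHβ
  have hHP : IsHeegnerPoint N W K P := ⟨Dt, H, ι, hPH⟩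
  refine ⟨ys, hys1, fun m hm hq ↦ hys m ⟨hm, hq⟩, ?_, ?_, ?_, ?_, ?_, ?_⟩
  · -- `ε = −w(E) = ±1`
    rcases W.rootNumber_eq_one_or with h | h
    · exact Or.inr (by rw [h])
    · exact Or.inl (by rw [h, neg_neg])
  · -- (B2) Gross (4.1): `P = Σ_{g ∈ 𝒢₁} g·y(1)` — the conductor-`1` transversal is all of `𝒢₁`
    intro T hT
    rw [hmapP, d₁.derivedPoint_one, hys1]
    exact Finset.sum_congr (Finset.ext fun g ↦ (d₁.mem_S_iff g).trans (hT g).symm) fun _ _ ↦ rfl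
  · -- (B3) Gross Prop. 5.3 at conductor `m`, from the tree's Shimura reciprocity at conductor `m`
    intro m hm0 τm hτm
    by_cases hm : Good m
    · obtain ⟨d, hdy⟩ := hdata m hm
      obtain ⟨σ', hσ', hfin⟩ := KolyvaginA53.h53_of_recM_of_eq_conductorNorm hN.symm hK hH Dt ι hβ
        (hgood0 m hm) (hgoodcop m hm) (d m dvd_rfl)
        (fun Q hQ hQβ ↦ exists_mem_ringClassGal_map_pointGalHom_y_eq_of_heegnerHypothesis hK ι hH Dt
          (hgood0 m hm) (hgoodcop m hm) (d m dvd_rfl) hQ hQβ) τm hτm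
      exact ⟨σ', hσ', by rwa [hdy m dvd_rfl] at hfin⟩
    · refine ⟨1, one_mem _, ?_⟩
      rw [hys0 m hm, map_zero, map_zero, smul_zero, sub_zero]
      exact IsOfFinAddOrder.zero
  · -- (B3₀) Darmon Prop. 3.11: `c P − ε P` torsion
    exact fun c hc ↦ KolyvaginAssembly.isOfFinAddOrder_map_sub_of_eq_conductorNorm hN.symm hK hH hHP c hc
  · -- (B4) Gross Prop. 3.7 (1): the tree THEOREM (x11b3 `HeegnerTrace`), generator at `ℓ` updated to the given one
    intro m hmsq hmq ℓ hℓ hle σ hσ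
    have hm : Good m := ⟨hmsq, hmq⟩
    obtain ⟨d, hdy⟩ := hdata m hm
    obtain ⟨hℓp, hℓm, -⟩ := Nat.mem_primeFactors.mp hℓ
    have hℓN : ¬ ℓ ∣ N := (hmq ℓ hℓ).1
    have hinert : (Ideal.span {(ℓ : 𝓞 K)}).IsPrime := (hmq ℓ hℓ).2
    have hℓn' : ¬ ℓ ∣ m / ℓ := fun h ↦ by
      have h2 : ℓ * ℓ ∣ m := by
        have := Nat.mul_dvd_mul_left ℓ h
        rwa [Nat.mul_div_cancel' hℓm] at this
      exact hℓp.one_lt.ne' (Nat.isUnit_iff.mp (hmsq ℓ h2))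
    have hNm : Nat.Coprime N m := (hgoodcop m hm).symm
    let dσ : KolyvaginHeegnerData Dt β ι m :=
      { (d m dvd_rfl) with
        σ := Function.update (d m dvd_rfl).σ ℓ σ
        zpowers_σ := fun q hq ↦ by
          by_cases hqℓ : q = ℓ
          · subst hqℓ
            rw [Function.update_self]
            exact hσ
          · rw [Function.update_of_ne hqℓ]
            exact (d m dvd_rfl).zpowers_σ q hq }
    have key := HeegnerTrace.sum_pow_pointGalHom_y_eq_lFunction_smul_map hK ι hND hℓ hinert hℓN hℓn'
      hNm (Or.inr hD) dσ (d (m / ℓ) (Nat.div_dvd_of_dvd hℓm)) hle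
    have hσℓ : dσ.σ ℓ = σ := Function.update_self ..
    have hyσ : dσ.y = ys m := hdy m dvd_rfl
    rw [hσℓ, hyσ, hdy (m / ℓ) (Nat.div_dvd_of_dvd hℓm)] at key
    haveI : Fact ℓ.Prime := ⟨hℓp⟩
    have hgood : W.HasGoodReductionAtPrime ℓ := by
      by_contra hbad
      exact hℓN (hN ▸ (W.dvd_conductorNorm_iff_not_hasGoodReductionAtPrime ℓ).mpr hbad)
    exact HeegnerTrace.frobeniusTrace_smul_eq_of_lFunction_smul_eq hgood key
  · -- (B5) Gross Prop. 3.7 (2) = Nekovář Prop. 4.13 (ii), the image-free PRINT input, on the datum with the GIVEN embedding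
    intro m hmsq hmq ℓ hℓ _ hΔ φ₀ hφ₀ hle emb hemb j hj γ _
    have hm : Good m := ⟨hmsq, hmq⟩
    obtain ⟨d, hdy⟩ := hdata m hm
    obtain ⟨hℓp, hℓm, -⟩ := Nat.mem_primeFactors.mp hℓ
    have hℓ2 : ℓ ≠ 2 := by
      rintro rfl
      exact h2 (hmq 2 hℓ).2
    let de : KolyvaginHeegnerData Dt β ι m := { (d m dvd_rfl) with emb := emb, emb_apply := hemb }
    have key := h372.reductionCongruence hN.symm hK hD34 hH hmsq (hgoodcop m hm) hℓ (Or.inl hℓ2) (hmq ℓ hℓ).2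
      de (d (m / ℓ) (Nat.div_dvd_of_dvd hℓm)) hΔ hφ₀ hle γ
    have hj' : j = de.toGeomPoints := by rw [hj]; rfl
    have hye : de.y = ys m := hdy m dvd_rfl
    rw [hye, hdy (m / ℓ) (Nat.div_dvd_of_dvd hℓm)] at key
    rw [hj']
    exact key

/-- **`ShimuraWalk.LabelsAt` at `S = ∅`**: the `X₀(N)` Heegner family of `exists_labelledFamily` carries lane B's printed-labels
predicate (`…ShimuraWalkDefs`, the binder of the port targets `SwapSupplyAtThree` ∕ `LevelSupplyAtThree` and of the carriers K4e ∕ D6)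
with `ε := −w(E)` and bottom point `P`. Same inputs; packaging only. [cite: GrossLMS1991, §3 Prop. 3.7 (1)(2), §4 (4.1), Prop. 5.3] -/
theorem exists_labelsAt [NeZero N] [W.IsElliptic] [W.IsGloballyMinimal]
    (hN : W.conductorNorm ℤ = N) (hK : IsImaginaryQuadratic K)
    (hD34 : NumberField.discr K ≠ -3 ∧ NumberField.discr K ≠ -4)
    (hH : SatisfiesHeegnerHypothesis N K)
    (h2 : ¬ (Ideal.span {((2 : ℕ) : 𝓞 K)}).IsPrime)
    (h372 : GrossLMS1991.prop37_2_frobeniusCongruence)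
    (Dt : ModularParametrizationData W N) {β : ℤ} (ι : K →+* ℂ)
    (d₁ : KolyvaginHeegnerData Dt β ι 1) {P : (W.baseChange K).toAffine.Point}
    (hPd : d₁.toGeomPoints d₁.derivedPoint = toGeomPoints (W.baseChange K) P) :
    ∃ ys : (m : ℕ) → (W.baseChange (ringClassField K ι m)).toAffine.Point,
      ys 1 = d₁.y ∧
      (∀ m : ℕ, Squarefree m → (∀ q ∈ m.primeFactors, ¬ q ∣ N ∧ (Ideal.span {(q : 𝓞 K)}).IsPrime) →
        WeierstrassCurve.Affine.Point.map (W' := W) (ringClassField K ι m).subtype.toRatAlgHom (ys m) =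
          heegnerPointComplexOfConductor Dt (NumberField.discr K) β m) ∧
      ShimuraWalk.LabelsAt W N K ι P ys (-W.rootNumber) := by
  obtain ⟨ys, h1, hcm, hε, hB2, hB3, hB3K, hB4, hB5⟩ :=
    exists_labelledFamily hN hK hD34 hH h2 h372 Dt ι d₁ hPd
  exact ⟨ys, h1, hcm, hε, hB2, hB3, hB3K, hB4, hB5⟩

end Summit.BirchSwinnertonDyer.BirchSwinnertonDyer.Theorems.ModularHeegnerLabels

end
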